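import Literature.Dynamics.Ergodic.ToralEndomorphismsKSEntropy
import Literature.AlgebraicGeometry.HodgeTheory.AbelianVarietyExpandingEndomorphismsBernoulliFactor
import HarnessLib

/-!
# The Kolmogorov–Sinai entropy of an isogeny of a complex abelian variety for the Haar measure

Lane `lit-hodgefound` (HODGE PATH, Track 2 foundations library; prover seat `lit-hodgefound-p31`, row g26-#3, FILE 2),
in the lineage «dynamics of endomorphisms of abelian varieties» — here part V, Kolmogorov–Sinai (measure-theoretic)
entropy, after the topological entropy of `AbelianVarietyEndomorphismEntropyMahlerMeasure.lean` (`h(f(ℂ)) = m(χ^r_f)`).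
The lane-side reading of `Literature/Dynamics/Ergodic/ToralEndomorphismsKSEntropy.lean` (FILE 1 of the row: Walters'
Thm 8.15, measure-theoretic half — `h_m(T_A) ≥ log|det A|` for non-singular `A`, `= log|det A| = m(χ_A)` for
expanding `A`), read on a complex torus `X = E/Φ(ℤ^ι)` and on a complex abelian variety through a uniformisation
`φ : X ≃ A(ℂ)` (✔ `complexAbelianVariety_torusUniformised`), for the Haar probability measure `μ` of `A(ℂ)` (the
translation-invariant Borel probability measure; `μ = φ_* vol`, ✔ `eq_map_volume_of_map_mul_right_eq`).

## Main statements (theorems only; no definition, no named fact)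

* `ComplexTorus.kolmogorovSinaiEntropy_mapMatrix_eq` — for `M` expanding, `h_vol(ρ(M)) = log|det M|` on a complex
  torus; `ComplexTorus.ofReal_log_abs_det_le_kolmogorovSinaiEntropy_mapMatrix` — `h_vol(ρ(M)) ≥ log|det M|` for every
  non-singular `M`.
* `kolmogorovSinaiEntropy_mapContinuous_eq_mapMatrix` — the Haar entropy of `f(ℂ)` is the Haar entropy of its
  rational representation `ρ_r(f)` acting on the uniformising torus (Walters Thm 4.11: entropy is a conjugacy
  invariant).
* **`AbelianVariety.kolmogorovSinaiEntropy_eq_log_deg_of_expanding`** — for an endomorphism `f` of a complex abelian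
  variety all of whose eigenvalues on `H¹(A(ℂ); ℚ)` have modulus `> 1` and the Haar probability measure `μ`:
  `h_μ(f(ℂ)) = log deg f = log #Ker f(ℂ)`.
* **`AbelianVariety.ofReal_log_deg_le_kolmogorovSinaiEntropy`** — for every ISOGENY `f`: `h_μ(f(ℂ)) ≥ log deg f`.

## References

* [Walters1982] P. Walters, *An Introduction to Ergodic Theory*, GTM 79 (1982), §8.4 Thm 8.15 (held text p. 212),
  §4.5 Thm 4.11 (p. 100), §0.6 Theorem 0.13 (uniqueness of the Haar probability measure).
* [Lange2023AbelianVarietiesComplex] H. Lange, *Abelian Varieties over the Complex Numbers*, Springer (2023), §1.1.2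
  Prop. 1.1.6, §1.1.3 Prop. 1.1.13 (c) (PDF pp. 19, 22): analytic and rational representations, `deg f = |det ρ_r(f)|`.
-/

noncomputable section

open Set Function Filter Topology MeasureTheory
open CategoryTheory
open Literature.Dynamics.TopologicalDynamics
open Literature.Dynamics.Ergodic
open Literature.AlgebraicTopology.SingularHomology Literature.NumberTheory.LFunctions
open Literature.NumberTheory.Transcendental (IsAnalytification)
open Literature.AlgebraicGeometry.Motives (ComplexPoints AbelianVariety AlgPoints specOver)
open scoped NNReal ENNReal Matrix

/-! ### §1 On a complex torus -/

namespace Literature.Geometry.Kaehler.ComplexTorus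

variable {ι : Type*} [Fintype ι] [DecidableEq ι] {E : Type*} [NormedAddCommGroup E] [NormedSpace ℂ E]
  (Φ : (ι → ℝ) ≃L[ℝ] E)

/-- **`h_vol(ρ(M)) ≥ log|det M|` on a complex torus** for every non-singular `M` (Haar probability measure `vol`).
[cite: Walters1982, §8.4 Thm 8.15 with Lemma 8.13, Thm 8.14 (held text pp. 210–212)] -/
theorem ofReal_log_abs_det_le_kolmogorovSinaiEntropy_mapMatrix (M : Matrix ι ι ℤ) (hdet : M.det ≠ 0) :
    ENNReal.ofReal (Real.log |((M.det : ℤ) : ℝ)|) ≤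
      kolmogorovSinaiEntropy (volume : Measure (ComplexTorus Φ)) (mapMatrix Φ Φ M) :=
  ToralEndomorphismKSEntropy.ofReal_log_abs_det_le_kolmogorovSinaiEntropy M (T := mapMatrix Φ Φ M)
    (fun _ _ ↦ rfl) hdet

/-- **`h_vol(ρ(M)) = log|det M|` on a complex torus for an expanding `M`** (every eigenvalue of modulus `> 1`).
[cite: Walters1982, §8.4 Thm 8.15 (held text p. 212)] -/
theorem kolmogorovSinaiEntropy_mapMatrix_eq (M : Matrix ι ι ℤ)
    (hexp : ∀ α ∈ (M.map (Int.castRingHom ℂ)).charpoly.roots, 1 < ‖α‖) :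
    kolmogorovSinaiEntropy (volume : Measure (ComplexTorus Φ)) (mapMatrix Φ Φ M) =
      ENNReal.ofReal (Real.log |((M.det : ℤ) : ℝ)|) :=
  ToralEndomorphismKSEntropy.kolmogorovSinaiEntropy_eq_ofReal_log_abs_det M (T := mapMatrix Φ Φ M)
    (fun _ _ ↦ rfl) hexp

/-- The translates `t ↦ ρ(M) t + c` of an expanding `ρ(M)` have the same Haar entropy `log|det M|`.
[cite: Walters1982, §8.4 Thm 8.15 (held text p. 212)] -/
theorem kolmogorovSinaiEntropy_mapMatrix_add_eq (M : Matrix ι ι ℤ)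
    (hexp : ∀ α ∈ (M.map (Int.castRingHom ℂ)).charpoly.roots, 1 < ‖α‖) (c : ComplexTorus Φ) :
    kolmogorovSinaiEntropy (volume : Measure (ComplexTorus Φ)) (fun t ↦ mapMatrix Φ Φ M t + c) =
      ENNReal.ofReal (Real.log |((M.det : ℤ) : ℝ)|) :=
  ToralEndomorphismKSEntropy.kolmogorovSinaiEntropy_affine_eq M (T := mapMatrix Φ Φ M) (fun _ _ ↦ rfl) hexp c
    (S := fun t ↦ mapMatrix Φ Φ M t + c) fun _ ↦ rfl

end Literature.Geometry.Kaehler.ComplexTorus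

/-! ### §2 On a complex abelian variety -/

namespace Literature.AlgebraicGeometry.HodgeTheory

open Literature.Geometry.Kaehler

section KSEntropy

variable (A : AbelianVariety ℂ) (f : A ⟶ A) [MeasurableSpace (ComplexPoints A.X)] [BorelSpace (ComplexPoints A.X)]
  (μ : Measure (ComplexPoints A.X)) [IsProbabilityMeasure μ]
  (hμ : ∀ Q : A.Points ℂ, Measure.map (fun P : A.Points ℂ ↦ P * Q) μ = μ)

include hμ in
/-- **The Haar entropy of `f(ℂ)` is the Haar entropy of its rational representation on the uniformising torus**:
if a group uniformisation `φ : E/Φ(ℤ^ι) ≃ A(ℂ)` conjugates `ρ(M)` to `f(ℂ)`, then `h_μ(f(ℂ)) = h_vol(ρ(M))` for the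
Haar probability measure `μ = φ_* vol` of `A(ℂ)` (entropy is a conjugacy invariant, Walters Thm 4.11).
[cite: Walters1982, §4.5 Thm 4.11 and §0.6 Theorem 0.13 (held text pp. 100, 22)]
[cite: Lange2023AbelianVarietiesComplex, §1.1.2 Prop. 1.1.6 (PDF p. 19)] -/
theorem kolmogorovSinaiEntropy_mapContinuous_eq_mapMatrix {ι : Type} [Fintype ι] [DecidableEq ι]
    {E : Type} [NormedAddCommGroup E] [NormedSpace ℂ E] [FiniteDimensional ℂ E] {Φ : (ι → ℝ) ≃L[ℝ] E}
    {φ : ComplexTorus Φ → ComplexPoints A.X} (hφ : IsAnalytification E A.X A.dim φ)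
    (hadd : ∀ x y, φ (x + y) = φ x * φ y) {M : Matrix ι ι ℤ}
    (hM : ∀ t, φ (ComplexTorus.mapMatrix Φ Φ M t) = AlgPoints.mapContinuous (L := ℂ) f.hom.hom.hom (φ t)) :
    kolmogorovSinaiEntropy μ (AlgPoints.mapContinuous (L := ℂ) f.hom.hom.hom) =
      kolmogorovSinaiEntropy (volume : Measure (ComplexTorus Φ)) (ComplexTorus.mapMatrix Φ Φ M) := by
  have hμφ := eq_map_volume_of_map_mul_right_eq A hφ hadd μ hμ
  set e := hφ.homeomorph.toMeasurableEquiv with he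
  have hecoe : (e : ComplexTorus Φ → ComplexPoints A.X) = φ := by
    rw [he, Homeomorph.toMeasurableEquiv_coe, IsAnalytification.coe_homeomorph]
  have hep : MeasurePreserving e volume μ := ⟨e.measurable, by rw [hecoe, hμφ]⟩
  have hsymm : ∀ P, φ (e.symm P) = P := fun P ↦ by
    have h := e.apply_symm_apply P
    rwa [hecoe] at h
  have hsemi : Semiconj e (ComplexTorus.mapMatrix Φ Φ M) (AlgPoints.mapContinuous (L := ℂ) f.hom.hom.hom) :=
    fun t ↦ by rw [hecoe, hM]
  have hsemi' : Semiconj e.symm (AlgPoints.mapContinuous (L := ℂ) f.hom.hom.hom) (ComplexTorus.mapMatrix Φ Φ M) :=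
    fun P ↦ e.injective (by rw [e.apply_symm_apply, hecoe, hM, hsymm])
  exact (kolmogorovSinaiEntropy_eq_of_semiconj hep (hep.symm e) hsemi hsemi'
    (ComplexTorus.continuous_mapMatrix M).measurable
    (AlgPoints.mapContinuous (L := ℂ) f.hom.hom.hom).continuous.measurable).symm

include hμ in
/-- **Through a uniformisation, expanding case:** if `φ` conjugates `f(ℂ)` to `ρ(M)` with every eigenvalue of `M`
of modulus `> 1`, then `h_μ(f(ℂ)) = log|det M|`. [cite: Walters1982, §8.4 Thm 8.15 (held text p. 212)]
[cite: Lange2023AbelianVarietiesComplex, §1.1.2 Prop. 1.1.6 (PDF p. 19)] -/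
theorem AbelianVariety.kolmogorovSinaiEntropy_eq_of_semiconj_of_expanding {ι : Type} [Fintype ι] [DecidableEq ι]
    {E : Type} [NormedAddCommGroup E] [NormedSpace ℂ E] [FiniteDimensional ℂ E] {Φ : (ι → ℝ) ≃L[ℝ] E}
    {φ : ComplexTorus Φ → ComplexPoints A.X} (hφ : IsAnalytification E A.X A.dim φ)
    (hadd : ∀ x y, φ (x + y) = φ x * φ y) (M : Matrix ι ι ℤ)
    (hM : ∀ t, φ (ComplexTorus.mapMatrix Φ Φ M t) = AlgPoints.mapContinuous (L := ℂ) f.hom.hom.hom (φ t))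
    (hexp : ∀ α ∈ (M.map (Int.castRingHom ℂ)).charpoly.roots, 1 < ‖α‖) :
    kolmogorovSinaiEntropy μ (AlgPoints.mapContinuous (L := ℂ) f.hom.hom.hom) =
      ENNReal.ofReal (Real.log |((M.det : ℤ) : ℝ)|) := by
  rw [kolmogorovSinaiEntropy_mapContinuous_eq_mapMatrix A f μ hμ hφ hadd hM,
    ComplexTorus.kolmogorovSinaiEntropy_mapMatrix_eq Φ M hexp]

include hμ in
/-- **The Kolmogorov–Sinai entropy of an expanding isogeny of a complex abelian variety for the Haar measure is
`log deg f`.**  Let `f : A → A` be an endomorphism every eigenvalue of whose action on `H¹(A(ℂ); ℚ)` has modulus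
`> 1` (so `f` is an isogeny, `deg f = #Ker f(ℂ) = |det ρ_r(f)|`) and `μ` the Haar probability measure of `A(ℂ)`.  Then
`h_μ(f(ℂ)) = log #Ker f(ℂ)` — Walters' Thm 8.15 «`h_m(A) = Σ_{|λᵢ|>1} log|λᵢ|`» for abelian varieties, the sum being
`log|det ρ_r(f)| = log deg f` in the expanding case.
[cite: Walters1982, §8.4 Thm 8.15 (held text p. 212)]
[cite: Lange2023AbelianVarietiesComplex, §1.1.2 Prop. 1.1.6, §1.1.3 Prop. 1.1.13 (c) (PDF pp. 19, 22)] -/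
theorem AbelianVariety.kolmogorovSinaiEntropy_eq_log_deg_of_expanding
    (h : ∀ α ∈ FrobeniusCharpoly.eigenvalues ℂ
      (singularCohomology.map ℚ ℚ (AlgPoints.mapContinuous (L := ℂ) f.hom.hom.hom) 1).hom, 1 < ‖α‖) :
    kolmogorovSinaiEntropy μ (AlgPoints.mapContinuous (L := ℂ) f.hom.hom.hom) =
      ENNReal.ofReal (Real.log (Nat.card (AbelianVariety.Hom.kerPoints (specOver ℂ ℂ) f))) := by
  obtain ⟨ι, _, _, Φ, φ, hφ, hadd⟩ := complexAbelianVariety_torusUniformised_holds A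
  obtain ⟨M, hM⟩ := exists_mapMatrix_comp_eq_of_hom Φ Φ ⟨φ, hφ.isHomeomorph.continuous⟩ hφ hadd
    ⟨φ, hφ.isHomeomorph.continuous⟩ hφ hadd f
  have hM' : ∀ t, φ (ComplexTorus.mapMatrix Φ Φ M t) = AlgPoints.mapContinuous (L := ℂ) f.hom.hom.hom (φ t) :=
    fun t ↦ hM t
  rw [eigenvalues_singularCohomology_map_one_eq_roots_charpoly A f hφ hM'] at h
  have hcard : Nat.card (AbelianVariety.Hom.kerPoints (specOver ℂ ℂ) f) = M.det.natAbs := by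
    rw [AbelianVariety.natCard_kerPoints_eq_natAbs_det_of_end f,
      det_singularHomology_map_one Φ A ⟨φ, hφ.isHomeomorph.continuous⟩ hφ
        (AlgPoints.mapContinuous (L := ℂ) f.hom.hom.hom) M hM]
  rw [hcard, AbelianVariety.kolmogorovSinaiEntropy_eq_of_semiconj_of_expanding A f μ hμ hφ hadd M hM' h,
    Nat.cast_natAbs, Int.cast_abs]

include hμ in
/-- **Every isogeny of a complex abelian variety has Haar entropy at least `log deg f`**: `h_μ(f(ℂ)) ≥ log #Ker f(ℂ)`
(Walters Thm 8.15: `h_m(A) = Σ_{|λᵢ|>1} log|λᵢ| ≥ log|det A|`; here the lower bound, for every non-singular rational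
representation). [cite: Walters1982, §8.4 Thm 8.15 with Lemma 8.13, Thm 8.14 (held text pp. 210–212)]
[cite: Lange2023AbelianVarietiesComplex, §1.1.2 Prop. 1.1.6, §1.1.3 Prop. 1.1.13 (c) (PDF pp. 19, 22)] -/
theorem AbelianVariety.ofReal_log_deg_le_kolmogorovSinaiEntropy (hf : Motives.AbelianVariety.IsIsogeny f) :
    ENNReal.ofReal (Real.log (Nat.card (AbelianVariety.Hom.kerPoints (specOver ℂ ℂ) f))) ≤
      kolmogorovSinaiEntropy μ (AlgPoints.mapContinuous (L := ℂ) f.hom.hom.hom) := by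
  obtain ⟨ι, _, _, Φ, φ, hφ, hadd⟩ := complexAbelianVariety_torusUniformised_holds A
  obtain ⟨M, hM⟩ := exists_mapMatrix_comp_eq_of_hom Φ Φ ⟨φ, hφ.isHomeomorph.continuous⟩ hφ hadd
    ⟨φ, hφ.isHomeomorph.continuous⟩ hφ hadd f
  have hM' : ∀ t, φ (ComplexTorus.mapMatrix Φ Φ M t) = AlgPoints.mapContinuous (L := ℂ) f.hom.hom.hom (φ t) :=
    fun t ↦ hM t
  have hdetH := det_singularHomology_map_one Φ A ⟨φ, hφ.isHomeomorph.continuous⟩ hφ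
    (AlgPoints.mapContinuous (L := ℂ) f.hom.hom.hom) M hM
  have hdet : M.det ≠ 0 := by
    rw [← hdetH]
    exact (AbelianVariety.isIsogeny_iff_det_singularHomology_map_one_ne_zero f).1 hf
  have hcard : Nat.card (AbelianVariety.Hom.kerPoints (specOver ℂ ℂ) f) = M.det.natAbs := by
    rw [AbelianVariety.natCard_kerPoints_eq_natAbs_det_of_end f, hdetH]
  rw [hcard, kolmogorovSinaiEntropy_mapContinuous_eq_mapMatrix A f μ hμ hφ hadd hM', Nat.cast_natAbs, Int.cast_abs]
  exact ComplexTorus.ofReal_log_abs_det_le_kolmogorovSinaiEntropy_mapMatrix Φ M hdet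

include hμ in
/-- In particular an expanding isogeny of degree `≥ 2` has POSITIVE Haar entropy, and every isogeny has entropy
`≥ 0 = log 1` with the bound `log deg f` attained exactly in the expanding case.
[cite: Walters1982, §8.4 Thm 8.15 (held text p. 212)] -/
theorem AbelianVariety.kolmogorovSinaiEntropy_pos_of_two_le_deg (hf : Motives.AbelianVariety.IsIsogeny f)
    (h2 : 2 ≤ Nat.card (AbelianVariety.Hom.kerPoints (specOver ℂ ℂ) f)) :
    0 < kolmogorovSinaiEntropy μ (AlgPoints.mapContinuous (L := ℂ) f.hom.hom.hom) :=
  lt_of_lt_of_le (ENNReal.ofReal_pos.2 (Real.log_pos (by exact_mod_cast h2)))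
    (AbelianVariety.ofReal_log_deg_le_kolmogorovSinaiEntropy A f μ hμ hf)

end KSEntropy

end Literature.AlgebraicGeometry.HodgeTheory
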